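import Mathlib
import Summits.ValiantsHypothesis.ValiantsHypothesis.Statement
import Summits.ValiantsHypothesis.ValiantsHypothesis.Theses.FreeSubtorus
import Summits.ValiantsHypothesis.ValiantsHypothesis.Theorems.FreeSubtorusSubtorusCovering
import Summits.ValiantsHypothesis.ValiantsHypothesis.Cruxes.OrbitDimensionBound.Lines.ConfusionLadder
import Literature.Computability.AlgebraicComplexity.PBoundedGrowth
import Literature.Computability.AlgebraicComplexity.EquivariantDC
import Literature.Computability.AlgebraicComplexity.DeterminantalComplexity

/-!
# `NoMinorLadder` — forward rung g5 over the proved floor `SubtorusCovering` (crux dir `OrbitDimensionBound`,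
# stmt-ValiantsHypothesis-16133, route `FreeSubtorus`): DROP ADMISSIBILITY

Floor (seed `g1-ValiantsHypothesis-16134`, PROVED as
`Theorems.FreeSubtorusSubtorusCovering.subtorusCovering_proof`): for `n ≥ 3`, an affine determinantal representation
`B` of `per_n` of size `m` that is `T_Λ`-equivariant with exact lifts, `Λ : Fin r → ([n] ⊔ [n]) → ℤ` ADMISSIBLE (every
generator has zero row-sum and zero column-sum, so that `T_Λ` contains all homotheties `(λ·1, μ·1)`), satisfies
`C(n, ⌊n/2⌋) ≤ m · 2^r`.

**The one move of this rung: the admissibility hypothesis is relaxed to "`T_Λ` fixes no proper minor of `per_n`".**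
The floor is the member `𝓐 = Admissible` of the family `CoveringOn 𝓐` indexed by a class `𝓐` of lattice data; the
class dial is `Admissible ⊂ NoInvariantMinor ⊂ Unconstrained` (bigger class = stronger statement, `CoveringOn.anti`),
and the rung is `NoMinorCovering := CoveringOn NoInvariantMinor`: `Λ` qualifies iff no indicator character
`(1_A ; 1_{σ(A)})` of a PROPER sub-matching (`∅ ≠ A ⊊ [n]`, `σ ∈ 𝔖_n`) lies in `span_ℚ {Λ_i}` — equivalently, no proper
minor `per(A × σ(A))` of `per_n` is `T_Λ`-invariant.  Admissible data qualify (indicators have positive row-mass,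
admissible spans have row-mass zero: `admissible_noInvariantMinor`), and so does the first NON-admissible member, the
per-INVARIANT torus `T'_1 = {∏_k d_k ∏_l e_l = 1}` (`Λ = 𝟙`, `r = 1`, no homothety of infinite order:
`noInvariantMinor_ones`, `not_admissible_ones`).

Why a new idea is needed there: the landed engine (`Theorems.FreeSubtorusConfusionCovering*`: generic element →
exact lift → graded form → Leibniz extraction → ACYCLIC unit flow is a path → class count) uses admissibility exactly
once, to make the weights `d_k e_l` free of non-negative multiplicative relations (`stub_genericElement` (ii),
`stub_pathWeights`' hypothesis, `exists_chain_of_flow`'s acyclicity); for `T'_1` every permutation monomial IS such a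
relation, and the flow's divergence data (`dim E_g(w) - dim E_h(w)`) vanishes identically because `per_n` is
`T'_1`-invariant, so the flow abstraction cannot see the path at all.  The line `Lines/no_minor_covering.lean` replaces
it by an INDEX-LEVEL walk: a graded NORMAL form (constant part `diag(0,1,…,1)` inside adapted bases) and the cycle of
the Leibniz permutation through the kernel column, which reads all of `σ` as soon as no proper sub-matching of `σ` has
weight product `1` — which is what `NoInvariantMinor` says at a generic element.

Contents: §1 classes and the family, floor = member (`coveringOn_admissible_iff`, `Iff.rfl`), rung, dial; §2 the
asymptotic shadow `ShadowOn 𝓐` and the ON-PATH lemma `ValiantsHypothesis → NoMinorShadow` (`noMinorShadow_of_summit`,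
`@[aesop safe apply]`; the summit is asymptotic and symmetry-free and implies no fixed-`n` inequality, but it implies the
shadow of every member: `dc(per_n) ≤ m_n`); §3 the symmetrisation target RELAXED by the rung, `OrbitNoMinorBound` (an
optimal expression re-realised at the same size under a no-invariant-minor subtorus of codimension `≤ n/2` — no
homothety lift demanded, cf. `Cruxes/OrbitDimensionBound/Disproof.lean` §3 `HomothetySymmetrisation`), with
`OrbitDimensionBound → OrbitNoMinorBound` and `closes_noMinor : OrbitNoMinorBound → NoMinorCovering → ValiantsHypothesis`.
[cite: LandsbergRessayre2017, Thm. 2.8, Question 2.2, §6] [cite: Odlyzko1988, p. 127] [cite: Vonzurgathen1987, Thm. 3.1]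
-/

set_option linter.dupNamespace false

noncomputable section

namespace Summit.ValiantsHypothesis.ValiantsHypothesis.Cruxes.OrbitDimensionBound.NoMinor

open Finset
open Literature.Computability.AlgebraicComplexity

/-! ## §1 Lattice classes, the covering family, the floor, the rung -/

/-- A class of lattice data `(n, r, Λ)`, `Λ : Fin r → ([n] ⊔ [n]) → ℤ` the generators cutting out the subtorus
`T_Λ = {(d, e) ∈ (ℂˣ)ⁿ × (ℂˣ)ⁿ : ∏_k d_k^{Λ_i(inl k)} ∏_l e_l^{Λ_i(inr l)} = 1 ∀ i}`. -/
abbrev LatticeClass : Type := (n r : ℕ) → (Fin r → (Fin n ⊕ Fin n) → ℤ) → Prop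

/-- ADMISSIBLE lattice data (the floor's hypothesis, verbatim): every generator has zero row-sum and zero column-sum,
i.e. `T_Λ` contains the homotheties `(λ·1, μ·1)`. [cite: LandsbergRessayre2017, §6] -/
def Admissible : LatticeClass := fun _ _ Λ => ∀ i, (∑ k, Λ i (Sum.inl k)) = 0 ∧ (∑ l, Λ i (Sum.inr l)) = 0

/-- The indicator character `(1_A ; 1_{σ(A)}) : [n] ⊔ [n] → ℤ` of the sub-matching `{(k, σ k) : k ∈ A}` of a
permutation `σ` — the weight of the minor monomial `∏_{k ∈ A} x_{k σ(k)}`. -/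
def minorVec {n : ℕ} (σ : Equiv.Perm (Fin n)) (A : Finset (Fin n)) : (Fin n ⊕ Fin n) → ℤ :=
  Sum.elim (fun k => if k ∈ A then 1 else 0) (fun l => if σ.symm l ∈ A then 1 else 0)

/-- `χ ∈ span_ℚ {Λ_i}` for an integer character `χ` (equivalently: `χ` is trivial on the identity component of `T_Λ`). -/
def InSpan {n r : ℕ} (Λ : Fin r → (Fin n ⊕ Fin n) → ℤ) (χ : (Fin n ⊕ Fin n) → ℤ) : Prop :=
  ∃ c : Fin r → ℚ, ∀ x, (χ x : ℚ) = ∑ i, c i * (Λ i x : ℚ)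

/-- **The rung's class `NoInvariantMinor`.**  No indicator character of a PROPER sub-matching of a permutation
(`∅ ≠ A ≠ [n]`) lies in `span_ℚ {Λ_i}`: no proper minor `per(A × σ(A))` of `per_n`, `0 < |A| < n`, is invariant under
(the identity component of) `T_Λ`.  Admissible data qualify; so do the per-invariant torus `T'_1` (`Λ = 𝟙`) and every
`Λ` whose span meets the non-negative orthant only in multiples of `𝟙`. -/
def NoInvariantMinor : LatticeClass := fun n _ Λ =>
  ∀ (σ : Equiv.Perm (Fin n)) (A : Finset (Fin n)), A.Nonempty → A ≠ Finset.univ → ¬ InSpan Λ (minorVec σ A)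

/-- The top of the dial: no constraint on `Λ` at all (NOT claimed by this rung; the next rung's territory). -/
def Unconstrained : LatticeClass := fun _ _ _ => True

/-- **The family `CoveringOn 𝓐`.**  For `n ≥ 3`: every affine determinantal representation `B` of `per_n` of size `m`
that is `T_Λ`-equivariant with exact `GL_m × GL_m` lifts, for lattice data `(n, r, Λ)` IN THE CLASS `𝓐`, satisfies
`C(n, ⌊n/2⌋) ≤ m · 2^r`.  The body is the floor `Theses.FreeSubtorus.SubtorusCovering` VERBATIM with the admissibility
hypothesis replaced by `𝓐 n r Λ`. [cite: LandsbergRessayre2017, Thm. 2.8, §6] -/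
def CoveringOn (𝓐 : LatticeClass) : Prop :=
  ∀ n : ℕ, 3 ≤ n → ∀ (m r : ℕ) (Λ : Fin r → (Fin n ⊕ Fin n) → ℤ)
    (B : Matrix (Fin m) (Fin m) (MvPolynomial (Fin n × Fin n) ℂ)),
    𝓐 n r Λ →
    Literature.Computability.AlgebraicComplexity.IsEquivariantDetRepr
      (Subgroup.closure {γ : Matrix.GeneralLinearGroup (Fin n × Fin n) ℂ |
        ∃ d e : Fin n → ℂˣ, (∀ i, (∏ k, (d k) ^ (Λ i (Sum.inl k))) * (∏ l, (e l) ^ (Λ i (Sum.inr l))) = 1) ∧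
          (γ : Matrix (Fin n × Fin n) (Fin n × Fin n) ℂ) = Matrix.diagonal (fun p => (d p.1 : ℂ) * (e p.2 : ℂ))})
      (Literature.Computability.AlgebraicComplexity.perPoly (Fin n) ℂ) B →
    Nat.choose n (n / 2) ≤ m * 2 ^ r

/-- **THE RUNG `NoMinorCovering`** (one move up from the floor: admissibility ↦ no invariant proper minor).  For
`n ≥ 3`, a `T_Λ`-equivariant affine determinantal representation of `per_n` of size `m`, `Λ` with `r` generators and no
invariant proper minor, has `C(n, ⌊n/2⌋) ≤ m · 2^r`. [cite: LandsbergRessayre2017, Thm. 2.8, §6] -/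
def NoMinorCovering : Prop := CoveringOn NoInvariantMinor

/-- The top member (all `Λ`), recorded for the ladder; NOT this rung. -/
def AnyLatticeCovering : Prop := CoveringOn Unconstrained

/-- Dial monotonicity (bigger class = stronger statement). [folklore] -/
theorem CoveringOn.anti {𝓐 𝓑 : LatticeClass} (hle : ∀ n r Λ, 𝓐 n r Λ → 𝓑 n r Λ) (h : CoveringOn 𝓑) :
    CoveringOn 𝓐 :=
  fun n hn m r Λ B hΛ hB => h n hn m r Λ B (hle n r Λ hΛ) hB

/-- **The member `𝓐 = Admissible` IS the floor statement, literally.** [folklore] -/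
theorem coveringOn_admissible_iff :
    CoveringOn Admissible ↔ Summit.ValiantsHypothesis.ValiantsHypothesis.Theses.FreeSubtorus.SubtorusCovering :=
  Iff.rfl

/-- **The floor is proved** (seed `g1-ValiantsHypothesis-16134`). [cite: LandsbergRessayre2017, Thm. 2.8] -/
theorem coveringOn_admissible : CoveringOn Admissible :=
  Summit.ValiantsHypothesis.ValiantsHypothesis.Theorems.FreeSubtorusSubtorusCovering.subtorusCovering_proof

/-- Admissible data have no invariant proper minor: an indicator `(1_A ; 1_{σ A})` has row-mass `|A| > 0`, every
rational combination of admissible generators has row-mass `0`. [folklore] -/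
theorem admissible_noInvariantMinor (n r : ℕ) (Λ : Fin r → (Fin n ⊕ Fin n) → ℤ) (hΛ : Admissible n r Λ) :
    NoInvariantMinor n r Λ := by
  classical
  intro σ A hA _ hspan
  obtain ⟨c, hc⟩ := hspan
  -- sum the coordinate identities over the row coordinates
  have hsum : ∑ k : Fin n, ((minorVec σ A (Sum.inl k) : ℤ) : ℚ) =
      ∑ k : Fin n, ∑ i : Fin r, c i * ((Λ i (Sum.inl k) : ℤ) : ℚ) :=
    Finset.sum_congr rfl fun k _ => hc (Sum.inl k)
  have hrhs : ∑ k : Fin n, ∑ i : Fin r, c i * ((Λ i (Sum.inl k) : ℤ) : ℚ) = 0 := by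
    rw [Finset.sum_comm]
    refine Finset.sum_eq_zero fun i _ => ?_
    rw [← Finset.mul_sum]
    have h1 : (∑ k : Fin n, ((Λ i (Sum.inl k) : ℤ) : ℚ)) = 0 := by exact_mod_cast (hΛ i).1
    rw [h1, mul_zero]
  have hlhs : ∑ k : Fin n, ((minorVec σ A (Sum.inl k) : ℤ) : ℚ) = (A.card : ℚ) := by
    simp [minorVec]
  rw [hlhs, hrhs] at hsum
  have hA0 : A.card = 0 := by exact_mod_cast hsum
  exact hA.ne_empty (Finset.card_eq_zero.1 hA0)

/-- The rung implies the floor (the class dial is antitone and `Admissible ⊆ NoInvariantMinor`). [folklore] -/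
theorem coveringOn_admissible_of_noMinorCovering (h : NoMinorCovering) : CoveringOn Admissible :=
  CoveringOn.anti admissible_noInvariantMinor h

/-- The rung implies the floor, by the floor's name. [folklore] -/
theorem subtorusCovering_of_noMinorCovering (h : NoMinorCovering) :
    Summit.ValiantsHypothesis.ValiantsHypothesis.Theses.FreeSubtorus.SubtorusCovering :=
  coveringOn_admissible_iff.1 (coveringOn_admissible_of_noMinorCovering h)

/-- The top member implies the rung. [folklore] -/
theorem noMinorCovering_of_anyLatticeCovering (h : AnyLatticeCovering) : NoMinorCovering :=
  CoveringOn.anti (fun _ _ _ _ => trivial) h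

/-- **The first member outside the floor's hypothesis: `Λ = 𝟙`** (`r = 1`, the per-INVARIANT torus
`T'_1 = {∏_k d_k ∏_l e_l = 1}`) has no invariant proper minor: `(1_A ; 1_{σ A}) = c · 𝟙` forces `c = 1` on `A` and
`c = 0` off `A`. [folklore] -/
theorem noInvariantMinor_ones (n : ℕ) : NoInvariantMinor n 1 (fun _ _ => 1) := by
  classical
  intro σ A hA hAu hspan
  obtain ⟨c, hc⟩ := hspan
  obtain ⟨k₁, hk₁⟩ := hA
  have hex : ∃ k₂, k₂ ∉ A := by
    by_contra hall
    push Not at hall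
    exact hAu (Finset.eq_univ_of_forall hall)
  obtain ⟨k₂, hk₂⟩ := hex
  have h1 := hc (Sum.inl k₁)
  have h2 := hc (Sum.inl k₂)
  simp only [minorVec, Sum.elim_inl, hk₁, if_true, if_neg hk₂, Int.cast_one, Int.cast_zero,
    Finset.univ_unique, Fin.default_eq_zero, Finset.sum_singleton, mul_one] at h1 h2
  rw [← h2] at h1
  exact one_ne_zero h1

/-- … and `Λ = 𝟙` is NOT admissible for `n ≥ 1` (row-sum `n ≠ 0`): the rung's class strictly contains the floor's.
[folklore] -/
theorem not_admissible_ones (n : ℕ) (hn : 1 ≤ n) : ¬ Admissible n 1 (fun _ _ => 1) := by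
  intro h
  have h1 : (∑ _k : Fin n, (1 : ℤ)) = 0 := (h 0).1
  simp at h1
  omega

/-! ## §2 The asymptotic shadow and the ON-PATH lemma `S → shadow` -/

/-- **Asymptotic shadow of `CoveringOn 𝓐`.**  Along ANY sequence `(Λ_n, B_n)` of lattice data in the class `𝓐` and
`T_{Λ_n}`-equivariant affine determinantal representations `B_n` of `per_n` of sizes `m_n` (`n ≥ 3`), the function
`n ↦ m_n · 2^{r_n}` is not p-bounded. [cite: LandsbergRessayre2017, Question 2.2] -/
def ShadowOn (𝓐 : LatticeClass) : Prop :=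
  ∀ (m r : ℕ → ℕ) (Λ : (n : ℕ) → Fin (r n) → (Fin n ⊕ Fin n) → ℤ)
    (B : (n : ℕ) → Matrix (Fin (m n)) (Fin (m n)) (MvPolynomial (Fin n × Fin n) ℂ)),
    (∀ n : ℕ, 3 ≤ n →
      𝓐 n (r n) (Λ n) ∧
      Literature.Computability.AlgebraicComplexity.IsEquivariantDetRepr
        (Subgroup.closure {γ : Matrix.GeneralLinearGroup (Fin n × Fin n) ℂ |
          ∃ d e : Fin n → ℂˣ, (∀ i, (∏ k, (d k) ^ (Λ n i (Sum.inl k))) * (∏ l, (e l) ^ (Λ n i (Sum.inr l))) = 1) ∧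
            (γ : Matrix (Fin n × Fin n) (Fin n × Fin n) ℂ) = Matrix.diagonal (fun p => (d p.1 : ℂ) * (e p.2 : ℂ))})
        (Literature.Computability.AlgebraicComplexity.perPoly (Fin n) ℂ) (B n)) →
    ¬ Literature.Computability.AlgebraicComplexity.IsPBounded (fun n => m n * 2 ^ r n)

/-- **The rung declaration handed to the forward kernel: the shadow of `NoMinorCovering`.** -/
def NoMinorShadow : Prop := ShadowOn NoInvariantMinor

/-- A numeric member implies its shadow (the middle binomial coefficient is not p-bounded:
`Literature…not_isPBounded_choose_middle`). [folklore] -/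
theorem shadowOn_of_coveringOn {𝓐 : LatticeClass} (h : CoveringOn 𝓐) : ShadowOn 𝓐 := by
  intro m r Λ B hyp hPB
  exact Literature.Computability.AlgebraicComplexity.not_isPBounded_choose_middle
    (IsPBounded.of_eventually_le 3 hPB fun n hn => h n hn (m n) (r n) (Λ n) (B n) (hyp n hn).1 (hyp n hn).2)

/-- The rung implies its shadow. [folklore] -/
theorem noMinorShadow_of_noMinorCovering (h : NoMinorCovering) : NoMinorShadow := shadowOn_of_coveringOn h

/-- The floor's shadow is a theorem. [folklore] -/
theorem shadowOn_admissible : ShadowOn Admissible := shadowOn_of_coveringOn coveringOn_admissible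

/-- **ON-PATH LEMMA `S → shadow`** for every class `𝓐`: `VP_ℂ ≠ VNP_ℂ` implies `ShadowOn 𝓐`, because
`dc(per_n) ≤ m_n ≤ m_n · 2^{r_n}` for `n ≥ 3`; a p-bounded `dc(per)` makes `per` a `VP` family
(`isVPFamily_of_isPBounded_determinantalComplexity`), hence `PER ∈ VP`, hence `VP = VNP`
(`perFamily_mem_VP_iff_VP_eq_VNP`).  Verbatim the argument of `Confusion.coveringShadow_of_summit`.
[cite: Burgisser2000, Thm. 2.10, §2.5] [cite: Valiant1979] -/
theorem shadowOn_of_summit (𝓐 : LatticeClass) (hS : _root_.ValiantsHypothesis) : ShadowOn 𝓐 := by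
  intro m r Λ B hyp hPB
  -- dc(per_n) is p-bounded
  have hdc : IsPBounded (fun n => determinantalComplexity (perPoly (Fin n) ℂ)) := by
    refine IsPBounded.of_eventually_le 3 hPB fun n hn => ?_
    have hrep : HasDetRepr (perPoly (Fin n) ℂ) (m n) := ⟨B n, (hyp n hn).2.1⟩
    calc determinantalComplexity (perPoly (Fin n) ℂ) ≤ m n := determinantalComplexity_le_of_hasDetRepr hrep
      _ = m n * 1 := (mul_one _).symm
      _ ≤ m n * 2 ^ r n := Nat.mul_le_mul_left _ Nat.one_le_two_pow
  -- hence per is a VP family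
  have hι : IsPBounded (fun n => Fintype.card (Fin n × Fin n)) :=
    (IsPBounded.mul_holds IsPBounded.id IsPBounded.id).mono fun n => by simp
  have hVP : IsVPFamily (fun n => perPoly (Fin n) ℂ) :=
    Summit.ValiantsHypothesis.Theorems.DeterminantalRigidityReductions.isVPFamily_of_isPBounded_determinantalComplexity
      hι hdc
  have hmem : perFamily ℂ ∈ VP ℂ := (mem_VP_ofFintype_iff_holds (fun n => perPoly (Fin n) ℂ)).2 hVP
  have hEq : VP ℂ = VNP ℂ := (perFamily_mem_VP_iff_VP_eq_VNP ℂ ringChar_complex_ne_two).1 hmem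
  exact hS hEq

/-- **`S → Rung` (shadow form), registered for the tribunal kernel's `intro h; aesop` probe.** [folklore] -/
@[aesop safe apply]
theorem noMinorShadow_of_summit (hS : _root_.ValiantsHypothesis) : NoMinorShadow :=
  shadowOn_of_summit NoInvariantMinor hS

/-- For the record: `S →` the shadow of the top member too. [folklore] -/
theorem anyShadow_of_summit (hS : _root_.ValiantsHypothesis) : ShadowOn Unconstrained :=
  shadowOn_of_summit Unconstrained hS

/-! ## §3 How the rung relaxes the open crux `OrbitDimensionBound` -/

/-- **`OrbitNoMinorBound`** — the symmetrisation target RELAXED by the rung: for `n ≥ 3`, every affine determinantal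
representation `A` of `per_n` of size `m` can be replaced by one, `B`, of the same size that is `T_Λ`-equivariant (exact
lifts) for SOME lattice data `Λ` with `r ≤ n/2` generators and NO INVARIANT PROPER MINOR — admissibility (a homothety
lift) is no longer demanded, so per-invariant stabilisers such as `T'_1` qualify.  `OrbitDimensionBound` implies it
(`orbitNoMinorBound_of_orbitDimensionBound`). [cite: LandsbergRessayre2017, Question 2.2, §6] -/
def OrbitNoMinorBound : Prop :=
  ∀ n : ℕ, 3 ≤ n → ∀ (m : ℕ) (A : Matrix (Fin m) (Fin m) (MvPolynomial (Fin n × Fin n) ℂ)),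
    Literature.Computability.AlgebraicComplexity.IsAffineDetRepr
      (Literature.Computability.AlgebraicComplexity.perPoly (Fin n) ℂ) A →
    ∃ (B : Matrix (Fin m) (Fin m) (MvPolynomial (Fin n × Fin n) ℂ)) (r : ℕ) (Λ : Fin r → (Fin n ⊕ Fin n) → ℤ),
      r ≤ n / 2 ∧ NoInvariantMinor n r Λ ∧
      Literature.Computability.AlgebraicComplexity.IsEquivariantDetRepr
        (Subgroup.closure {γ : Matrix.GeneralLinearGroup (Fin n × Fin n) ℂ |
          ∃ d e : Fin n → ℂˣ, (∀ i, (∏ k, (d k) ^ (Λ i (Sum.inl k))) * (∏ l, (e l) ^ (Λ i (Sum.inr l))) = 1) ∧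
            (γ : Matrix (Fin n × Fin n) (Fin n × Fin n) ℂ) = Matrix.diagonal (fun p => (d p.1 : ℂ) * (e p.2 : ℂ))})
        (Literature.Computability.AlgebraicComplexity.perPoly (Fin n) ℂ) B

/-- The host crux implies the relaxed target (admissible data have no invariant proper minor). [folklore] -/
theorem orbitNoMinorBound_of_orbitDimensionBound
    (h : Summit.ValiantsHypothesis.ValiantsHypothesis.Theses.FreeSubtorus.OrbitDimensionBound) :
    OrbitNoMinorBound := by
  intro n hn m A hA
  obtain ⟨B, r, Λ, hr, hΛ, hB⟩ := h n hn m A hA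
  exact ⟨B, r, Λ, hr, admissible_noInvariantMinor n r Λ hΛ, hB⟩

/-- **The relaxed closing: `OrbitNoMinorBound → NoMinorCovering → ValiantsHypothesis`.**  An optimal expression of
`per_n` (`hasDetRepr_determinantalComplexity_holds`) is re-realised at size `dc(per_n)` under a no-invariant-minor
`T_Λ` with `r ≤ n/2`; the rung gives `C(n,⌊n/2⌋) ≤ dc(per_n) · 2^r ≤ dc(per_n) · 2^{⌊n/2⌋}`; the arithmetic tail is the
host route's (`Confusion.vh_of_middle_bound`, copied from `Theses.FreeSubtorus.closes`).  This is the host route's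
`closes` with crux #2 strengthened to the rung and crux #1 relaxed. [cite: LandsbergRessayre2017, Thm. 2.8, Question 2.2] -/
theorem closes_noMinor (h₁ : OrbitNoMinorBound) (h₂ : NoMinorCovering) : _root_.ValiantsHypothesis := by
  refine Confusion.vh_of_middle_bound fun n hn => ?_
  obtain ⟨A, hA⟩ := Literature.Computability.AlgebraicComplexity.hasDetRepr_determinantalComplexity_holds
    (Literature.Computability.AlgebraicComplexity.perPoly (Fin n) ℂ)
  obtain ⟨B, r, Λ, hr, hΛ, hB⟩ := h₁ n hn _ A hA
  have h := h₂ n hn _ r Λ B hΛ hB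
  calc Nat.choose n (n / 2)
      ≤ Literature.Computability.AlgebraicComplexity.determinantalComplexity
          (Literature.Computability.AlgebraicComplexity.perPoly (Fin n) ℂ) * 2 ^ r := h
    _ ≤ Literature.Computability.AlgebraicComplexity.determinantalComplexity
          (Literature.Computability.AlgebraicComplexity.perPoly (Fin n) ℂ) * 2 ^ (n / 2) :=
        Nat.mul_le_mul_left _ (Nat.pow_le_pow_right (by norm_num) hr)

/-- For comparison: the host route's own closing from the floor, by name (`OrbitDimensionBound → VH`). -/
theorem closes_floor (h₁ : Summit.ValiantsHypothesis.ValiantsHypothesis.Theses.FreeSubtorus.OrbitDimensionBound) :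
    _root_.ValiantsHypothesis :=
  Summit.ValiantsHypothesis.ValiantsHypothesis.Theses.FreeSubtorus.closes h₁ coveringOn_admissible

end Summit.ValiantsHypothesis.ValiantsHypothesis.Cruxes.OrbitDimensionBound.NoMinor

end
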